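import Summits.CriticalPhenomena.PercolationContinuityZ3.Theorems.PercNearOneGluingNoHeavyLowerTailSahiGridPatternTwoOrthantTop
import Summits.CriticalPhenomena.PercolationContinuityZ3.Theorems.PercNearOneGluingNoHeavyLowerTailSahiGridPatternOrthantGrid

/-!
# `NoHeavyLowerTail` (crux stmt-CriticalPhenomena-4575), Sahi programme P1: **THE TWO-ORTHANT THEOREM FOR ARBITRARY DISJOINT SUPPORTS,
# AND KAHN'S INEQUALITY `E₃ ≥ 0` FOR AN OR OF TWO ANDS** (value level)

Support file (Sahi cell, seat `prim-sahi-p1`, generation 21; `--supports stmt-CriticalPhenomena-4575`).  Pure proofs, no definitions,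
no `sorry`, standard axioms.

THE MATHEMATICS.  `sStarD` is invariant under re-indexing the axes along any equivalence `e : Fin d' ≃ Fin d` (`tcD_comp_equiv`), so
goodness of a first slot transfers along such re-indexings (`sStarD_nonneg_transfer`).  Re-indexing the block form of the two-orthant
theorem (`sStarD_cylSet_twoOrthant_nonneg`: free axes first, then the two orthant blocks) along the equivalence that lists the complement,
then `S₁`, then `S₂` gives the SUPPORT-FREE form **`sStarD_twoOrthant_union_nonneg`**: for every `d`, all disjoint `S₁, S₂ ⊆ Fin d` and all
thresholds `t₁, t₂ : Fin d → Fin 3`, the up-set `U = {p : (∀ a ∈ S₁, t₁ a ≤ p a) ∨ (∀ a ∈ S₂, t₂ a ≤ p a)} ⊆ [3]^d` satisfies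
`0 ≤ sStarD U B C` for all up-sets `B, C` (axes of `Sᵢ` with threshold `0` are dropped first; if nothing is left of a block the slot is the
whole cube).  VALUE LEVEL (template `Ssym_nonneg_coorthant`): after sorting a three-point sample of a grid axis by axis, the event
`A = {x : (∀ a ∈ S₁, c₁ a ≤ x a) ∨ (∀ a ∈ S₂, c₂ a ≤ x a)}` pulls back to such a union, to a single orthant, or to `∅` (`threshold_three_le`, `sStarD_empty_left`),
so (**`latticeE3_gridProd_nonneg_orOfAnds`**, **`sahiE_three_orOfAnds_nonneg`**) `E₃(1_A,1_B,1_C) ≥ 0` for every nonnegative product weight on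
every grid `[K+1]^d`, every such `A` and all up-sets `B, C` — Kahn's Conjecture 5 (= Sahi's `C₃`, order 3) when one event is an OR of two
ANDs of one-variable threshold events on disjoint variable sets (a read-once monotone DNF of width two), the other two arbitrary. [this work]
-/

namespace Summit.CriticalPhenomena.PercolationContinuityZ3.Theorems.SahiGridPattern

open Finset SahiGrid3 Literature.Probability.LatticeModels Literature.Combinatorics.Sahi2008
open scoped BigOperators

/-! ### Re-indexing the axes along an arbitrary equivalence -/

/-- The pattern tensor is invariant under re-indexing the axes. [this work] -/
theorem tcD_comp_equiv {d d' : ℕ} (e : Fin d' ≃ Fin d) (p q r : Pd d) :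
    tcD (d := d') (p ∘ e) (q ∘ e) (r ∘ e) = tcD p q r := by
  unfold tcD
  simp only [Function.comp_apply]
  rw [Equiv.prod_comp e (fun a => c1 (p a) (q a) (r a)), Equiv.prod_comp e (fun a => c2 (p a) (q a) (r a)),
    Equiv.prod_comp e (fun a => c2 (q a) (p a) (r a)), Equiv.prod_comp e (fun a => c2 (r a) (p a) (q a)),
    Equiv.prod_comp e (fun a => c3 (p a) (q a) (r a))]

/-- Precomposition with `e : Fin d' ≃ Fin d` as an equivalence `[3]^d ≃ [3]^{d'}`. [this work] -/
theorem isUpperSet_map_comp_equiv {d d' : ℕ} (e : Fin d' ≃ Fin d) {B : Finset (Pd d)} (hB : IsUpperSet (B : Set (Pd d))) :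
    IsUpperSet ((B.map (Equiv.arrowCongr e.symm (Equiv.refl (Fin 3))).toEmbedding : Finset (Pd d')) : Set (Pd d')) := by
  intro x y hxy hx
  rw [Finset.mem_coe, Finset.mem_map_equiv] at hx ⊢
  refine hB (fun a => ?_) hx
  simp only [Equiv.arrowCongr_symm, Equiv.arrowCongr_apply, Equiv.symm_symm, Equiv.refl_symm, Equiv.coe_refl,
    Function.comp_apply, id_eq]
  exact hxy _

/-- **Transfer of a good first slot along an axis re-indexing**: if `p ∈ A' ↔ p ∘ e ∈ A` for an equivalence `e : Fin d' ≃ Fin d` and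
`sStarD A B C ≥ 0` for all up-sets `B, C ⊆ [3]^{d'}`, then `sStarD A' B C ≥ 0` for all up-sets `B, C ⊆ [3]^d`. [this work] -/
theorem sStarD_nonneg_transfer {d d' : ℕ} (e : Fin d' ≃ Fin d) {A : Finset (Pd d')} {A' : Finset (Pd d)}
    (hA : ∀ B C : Finset (Pd d'), IsUpperSet (B : Set (Pd d')) → IsUpperSet (C : Set (Pd d')) → 0 ≤ sStarD A B C)
    (h : ∀ p : Pd d, p ∈ A' ↔ (p ∘ e) ∈ A) :
    ∀ B C : Finset (Pd d), IsUpperSet (B : Set (Pd d)) → IsUpperSet (C : Set (Pd d)) → 0 ≤ sStarD A' B C := by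
  intro B' C' hB' hC'
  let E : Pd d ≃ Pd d' := Equiv.arrowCongr e.symm (Equiv.refl (Fin 3))
  have hE : ∀ p : Pd d, E p = p ∘ e := by
    intro p; funext a
    simp only [E, Equiv.arrowCongr_apply, Equiv.symm_symm, Equiv.coe_refl, Function.comp_apply, id_eq]
  have hsum : sStarD A' B' C' = sStarD A (B'.map E.toEmbedding) (C'.map E.toEmbedding) := by
    rw [sStarD_eq_sum_tcD, sStarD_eq_sum_tcD]
    refine Finset.sum_equiv E (fun p => ?_) fun p _ => ?_
    · rw [h p, hE]
    · refine Finset.sum_equiv E (fun q => ?_) fun q _ => ?_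
      · rw [Finset.mem_map_equiv, Equiv.symm_apply_apply]
      · refine Finset.sum_equiv E (fun r => ?_) fun r _ => ?_
        · rw [Finset.mem_map_equiv, Equiv.symm_apply_apply]
        · rw [hE, hE, hE, tcD_comp_equiv]
  rw [hsum]
  exact hA _ _ (isUpperSet_map_comp_equiv e hB') (isUpperSet_map_comp_equiv e hC')

/-! ### The equivalence listing the complement, then `S₁`, then `S₂` -/

/-- For disjoint `S₁, S₂ ⊆ Fin d` with complement `R`: an equivalence `Fin (#R + (#S₁ + #S₂)) ≃ Fin d` mapping the middle block onto `S₁`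
and the last block onto `S₂`. [this work] -/
theorem exists_block_equiv {d : ℕ} (S₁ S₂ : Finset (Fin d)) (hdisj : Disjoint S₁ S₂) :
    ∃ e : Fin ((S₁ ∪ S₂)ᶜ.card + (S₁.card + S₂.card)) ≃ Fin d,
      (∀ i : Fin S₁.card, e (Fin.natAdd _ (Fin.castAdd _ i)) ∈ S₁) ∧
      (∀ j : Fin S₂.card, e (Fin.natAdd _ (Fin.natAdd _ j)) ∈ S₂) ∧
      (∀ s ∈ S₁, ∃ i : Fin S₁.card, e (Fin.natAdd _ (Fin.castAdd _ i)) = s) ∧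
      (∀ s ∈ S₂, ∃ j : Fin S₂.card, e (Fin.natAdd _ (Fin.natAdd _ j)) = s) := by
  classical
  set R : Finset (Fin d) := (S₁ ∪ S₂)ᶜ with hR
  -- the map from the sum of the three subtypes to `Fin d`
  let f : (↥R ⊕ (↥S₁ ⊕ ↥S₂)) → Fin d := fun x => match x with
    | Sum.inl r => r.1
    | Sum.inr (Sum.inl s) => s.1
    | Sum.inr (Sum.inr s) => s.1
  have hf_inj : Function.Injective f := by
    rintro (⟨r, hr⟩ | ⟨s, hs⟩ | ⟨s, hs⟩) (⟨r', hr'⟩ | ⟨s', hs'⟩ | ⟨s', hs'⟩) hxy <;> simp only [f] at hxy <;> subst hxy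
    · rfl
    · exfalso; rw [hR, Finset.mem_compl] at hr; exact hr (Finset.mem_union_left _ hs')
    · exfalso; rw [hR, Finset.mem_compl] at hr; exact hr (Finset.mem_union_right _ hs')
    · exfalso; rw [hR, Finset.mem_compl] at hr'; exact hr' (Finset.mem_union_left _ hs)
    · rfl
    · exfalso; exact Finset.disjoint_left.1 hdisj hs hs'
    · exfalso; rw [hR, Finset.mem_compl] at hr'; exact hr' (Finset.mem_union_right _ hs)
    · exfalso; exact Finset.disjoint_left.1 hdisj hs' hs
    · rfl
  have hf_surj : Function.Surjective f := by
    intro a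
    by_cases h1 : a ∈ S₁
    · exact ⟨Sum.inr (Sum.inl ⟨a, h1⟩), rfl⟩
    by_cases h2 : a ∈ S₂
    · exact ⟨Sum.inr (Sum.inr ⟨a, h2⟩), rfl⟩
    · refine ⟨Sum.inl ⟨a, ?_⟩, rfl⟩
      rw [hR, Finset.mem_compl, Finset.mem_union, not_or]; exact ⟨h1, h2⟩
  let g : (↥R ⊕ (↥S₁ ⊕ ↥S₂)) ≃ Fin d := Equiv.ofBijective f ⟨hf_inj, hf_surj⟩
  -- the numeric side
  let h0 : Fin (R.card + (S₁.card + S₂.card)) ≃ (Fin R.card ⊕ (Fin S₁.card ⊕ Fin S₂.card)) :=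
    finSumFinEquiv.symm.trans (Equiv.sumCongr (Equiv.refl _) finSumFinEquiv.symm)
  let h1 : (Fin R.card ⊕ (Fin S₁.card ⊕ Fin S₂.card)) ≃ (↥R ⊕ (↥S₁ ⊕ ↥S₂)) :=
    Equiv.sumCongr R.equivFin.symm (Equiv.sumCongr S₁.equivFin.symm S₂.equivFin.symm)
  refine ⟨(h0.trans h1).trans g, ?_, ?_, ?_, ?_⟩
  · intro i
    have e1 : h0 (Fin.natAdd _ (Fin.castAdd _ i)) = Sum.inr (Sum.inl i) := by
      simp [h0, finSumFinEquiv_symm_apply_natAdd, finSumFinEquiv_symm_apply_castAdd]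
    simp only [Equiv.trans_apply, e1]
    simp [h1, g, f, Equiv.ofBijective_apply]
  · intro j
    have e1 : h0 (Fin.natAdd _ (Fin.natAdd _ j)) = Sum.inr (Sum.inr j) := by
      simp [h0, finSumFinEquiv_symm_apply_natAdd]
    simp only [Equiv.trans_apply, e1]
    simp [h1, g, f, Equiv.ofBijective_apply]
  · intro s hs
    refine ⟨S₁.equivFin ⟨s, hs⟩, ?_⟩
    have e1 : h0 (Fin.natAdd _ (Fin.castAdd _ (S₁.equivFin ⟨s, hs⟩))) = Sum.inr (Sum.inl (S₁.equivFin ⟨s, hs⟩)) := by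
      simp [h0, finSumFinEquiv_symm_apply_natAdd, finSumFinEquiv_symm_apply_castAdd]
    simp only [Equiv.trans_apply, e1]
    simp [h1, g, f, Equiv.ofBijective_apply]
  · intro s hs
    refine ⟨S₂.equivFin ⟨s, hs⟩, ?_⟩
    have e1 : h0 (Fin.natAdd _ (Fin.natAdd _ (S₂.equivFin ⟨s, hs⟩))) = Sum.inr (Sum.inr (S₂.equivFin ⟨s, hs⟩)) := by
      simp [h0, finSumFinEquiv_symm_apply_natAdd]
    simp only [Equiv.trans_apply, e1]
    simp [h1, g, f, Equiv.ofBijective_apply]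

/-! ### The support-free two-orthant theorem -/

/-- **THE TWO-ORTHANT THEOREM FOR ARBITRARY DISJOINT SUPPORTS** (every `d`): for disjoint `S₁, S₂ ⊆ Fin d` and thresholds
`t₁, t₂ : Fin d → Fin 3`, the up-set `{p : (∀ a ∈ S₁, t₁ a ≤ p a) ∨ (∀ a ∈ S₂, t₂ a ≤ p a)}` is a good first slot of the pattern functional:
`0 ≤ sStarD U B C` for all up-sets `B, C ⊆ [3]^d`. [this work] -/
theorem sStarD_twoOrthant_union_nonneg {d : ℕ} (S₁ S₂ : Finset (Fin d)) (hdisj : Disjoint S₁ S₂) (t₁ t₂ : Fin d → Fin 3)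
    {B C : Finset (Pd d)} (hB : IsUpperSet (B : Set (Pd d))) (hC : IsUpperSet (C : Set (Pd d))) :
    0 ≤ sStarD (univ.filter fun p : Pd d => (∀ a ∈ S₁, t₁ a ≤ p a) ∨ (∀ a ∈ S₂, t₂ a ≤ p a)) B C := by
  classical
  -- drop the axes with threshold 0
  have hdisj' : Disjoint (S₁.filter fun a => t₁ a ≠ 0) (S₂.filter fun a => t₂ a ≠ 0) := Finset.disjoint_filter_filter hdisj
  have k1 : ∀ p : Pd d, (∀ a ∈ S₁, t₁ a ≤ p a) ↔ (∀ a ∈ S₁.filter (fun a => t₁ a ≠ 0), t₁ a ≤ p a) := by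
    intro p
    constructor
    · intro h a ha; rw [Finset.mem_filter] at ha; exact h a ha.1
    · intro h a ha
      by_cases hz : t₁ a = 0
      · rw [hz]; exact Fin.zero_le _
      · exact h a (Finset.mem_filter.2 ⟨ha, hz⟩)
  have k2 : ∀ p : Pd d, (∀ a ∈ S₂, t₂ a ≤ p a) ↔ (∀ a ∈ S₂.filter (fun a => t₂ a ≠ 0), t₂ a ≤ p a) := by
    intro p
    constructor
    · intro h a ha; rw [Finset.mem_filter] at ha; exact h a ha.1
    · intro h a ha
      by_cases hz : t₂ a = 0
      · rw [hz]; exact Fin.zero_le _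
      · exact h a (Finset.mem_filter.2 ⟨ha, hz⟩)
  have hred : (univ.filter fun p : Pd d => (∀ a ∈ S₁, t₁ a ≤ p a) ∨ (∀ a ∈ S₂, t₂ a ≤ p a))
      = univ.filter fun p : Pd d => (∀ a ∈ S₁.filter (fun a => t₁ a ≠ 0), t₁ a ≤ p a) ∨ (∀ a ∈ S₂.filter (fun a => t₂ a ≠ 0), t₂ a ≤ p a) :=
    Finset.filter_congr fun p _ => or_congr (k1 p) (k2 p)
  rw [hred]
  -- if one block is empty the slot is the whole cube
  by_cases h1 : S₁.filter (fun a => t₁ a ≠ 0) = ∅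
  · have e : (univ.filter fun p : Pd d => (∀ a ∈ S₁.filter (fun a => t₁ a ≠ 0), t₁ a ≤ p a) ∨ (∀ a ∈ S₂.filter (fun a => t₂ a ≠ 0), t₂ a ≤ p a)) = univ := by
      refine Finset.filter_true_of_mem fun p _ => Or.inl ?_
      rw [h1]; intro a ha; simp at ha
    rw [e]; exact sStarD_nonneg_of_eq_univ₁ hB hC
  by_cases h2 : S₂.filter (fun a => t₂ a ≠ 0) = ∅
  · have e : (univ.filter fun p : Pd d => (∀ a ∈ S₁.filter (fun a => t₁ a ≠ 0), t₁ a ≤ p a) ∨ (∀ a ∈ S₂.filter (fun a => t₂ a ≠ 0), t₂ a ≤ p a)) = univ := by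
      refine Finset.filter_true_of_mem fun p _ => Or.inr ?_
      rw [h2]; intro a ha; simp at ha
    rw [e]; exact sStarD_nonneg_of_eq_univ₁ hB hC
  -- otherwise re-index into block form
  obtain ⟨e, he1, he2, hs1, hs2⟩ := exists_block_equiv (S₁.filter fun a => t₁ a ≠ 0) (S₂.filter fun a => t₂ a ≠ 0) hdisj'
  have hnpos : 0 < (S₁.filter fun a => t₁ a ≠ 0).card := Finset.card_pos.2 (Finset.nonempty_iff_ne_empty.2 h1)
  have ha : ∀ i : Fin (S₁.filter fun a => t₁ a ≠ 0).card,
      (fun i => t₁ (e (Fin.natAdd _ (Fin.castAdd _ i)))) i ≠ 0 := by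
    intro i
    have hm := he1 i
    rw [Finset.mem_filter] at hm
    exact hm.2
  refine sStarD_nonneg_transfer e (fun B' C' hB' hC' => sStarD_cylSet_twoOrthant_nonneg (m := ((S₁.filter fun a => t₁ a ≠ 0) ∪ (S₂.filter fun a => t₂ a ≠ 0))ᶜ.card)
    (fun i => t₁ (e (Fin.natAdd _ (Fin.castAdd _ i)))) ha hnpos (fun j => t₂ (e (Fin.natAdd _ (Fin.natAdd _ j)))) hB' hC') (fun p => ?_) B C hB hC
  -- membership: the re-indexed point lies in the cylinder iff `p` lies in the union
  rw [Finset.mem_filter, mem_cylSet_iff, Finset.mem_union, Finset.mem_filter, Finset.mem_filter]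
  simp only [Finset.mem_univ, true_and]
  have c1 : (∀ s ∈ S₁.filter (fun a => t₁ a ≠ 0), t₁ s ≤ p s) ↔
      (∀ i : Fin (S₁.filter fun a => t₁ a ≠ 0).card, t₁ (e (Fin.natAdd _ (Fin.castAdd _ i))) ≤ cellOf (p ∘ e) (Fin.castAdd _ i)) := by
    constructor
    · intro h i; exact h _ (he1 i)
    · intro h s hs
      obtain ⟨i, hi⟩ := hs1 s hs
      have := h i
      rw [← hi]; exact this
  have c2 : (∀ s ∈ S₂.filter (fun a => t₂ a ≠ 0), t₂ s ≤ p s) ↔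
      (∀ j : Fin (S₂.filter fun a => t₂ a ≠ 0).card, t₂ (e (Fin.natAdd _ (Fin.natAdd _ j))) ≤ cellOf (p ∘ e) (Fin.natAdd _ j)) := by
    constructor
    · intro h j; exact h _ (he2 j)
    · intro h s hs
      obtain ⟨j, hj⟩ := hs2 s hs
      have := h j
      rw [← hj]; exact this
  rw [c1, c2]


/-! ### Value level: Kahn's inequality for an OR of two ANDs -/

variable {d K : ℕ}

/-- Non-strict thresholds: for a monotone triple `v₀ ≤ v₁ ≤ v₂` the set `{c : x ≤ v_c}` is empty or `{c : t ≤ c}` for some `t`. [this work] -/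
theorem threshold_three_le {α : Type*} [Preorder α] (v : Fin 3 → α) (hv : Monotone v) (x : α) :
    (∀ c : Fin 3, ¬ x ≤ v c) ∨ ∃ t : Fin 3, ∀ c : Fin 3, (x ≤ v c ↔ t ≤ c) := by
  by_cases h0 : x ≤ v 0
  · refine Or.inr ⟨0, fun c => iff_of_true (le_trans h0 (hv (Fin.zero_le _))) (Fin.zero_le _)⟩
  by_cases h1 : x ≤ v 1
  · refine Or.inr ⟨1, fun c => ?_⟩
    fin_cases c
    · exact iff_of_false h0 (by decide)
    · exact iff_of_true h1 (by decide)
    · exact iff_of_true (le_trans h1 (hv (by decide))) (by decide)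
  by_cases h2 : x ≤ v 2
  · refine Or.inr ⟨2, fun c => ?_⟩
    fin_cases c
    · exact iff_of_false h0 (by decide)
    · exact iff_of_false h1 (by decide)
    · exact iff_of_true h2 (by decide)
  · refine Or.inl fun c => ?_
    fin_cases c
    · exact h0
    · exact h1
    · exact h2

/-- **The symmetrised pattern value of (OR of two ANDs, up-set, up-set) is nonnegative** at every three-point sample `ω` of the grid:
after sorting, the first event pulls back to a union of two orthants with disjoint supports, to a single orthant, or to `∅`. [this work] -/
theorem Ssym_nonneg_orOfAnds (S₁ S₂ : Finset (Fin d)) (hdisj : Disjoint S₁ S₂) (c₁ c₂ : Fin d → Fin (K + 1))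
    {B C : Finset (Xd d K)} (hB : IsUpperSet (B : Set (Xd d K))) (hC : IsUpperSet (C : Set (Xd d K))) (ω : Fin 3 → Xd d K) :
    0 ≤ Ssym (univ.filter fun x : Xd d K => (∀ a ∈ S₁, c₁ a ≤ x a) ∨ (∀ a ∈ S₂, c₂ a ≤ x a)) B C ω := by
  classical
  set A : Finset (Xd d K) := univ.filter fun x : Xd d K => (∀ a ∈ S₁, c₁ a ≤ x a) ∨ (∀ a ∈ S₂, c₂ a ≤ x a) with hAdef
  let σ : Fin d → Equiv.Perm (Fin 3) := fun a => Tuple.sort fun c => ω c a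
  have hsort : ∀ a, Monotone fun c => Tmap σ ω c a := fun a => by
    show Monotone ((fun c => ω c a) ∘ σ a)
    exact Tuple.monotone_sort _
  rw [← S_Tmap A B C σ ω, S_eq_sStarD]
  set ω' : Fin 3 → Xd d K := Tmap σ ω with hω'
  have hB' := isUpperSet_pb hsort hB
  have hC' := isUpperSet_pb hsort hC
  have mem_pb : ∀ p : Pd d, p ∈ pb ω' A ↔ ((∀ a ∈ S₁, c₁ a ≤ ω' (p a) a) ∨ (∀ a ∈ S₂, c₂ a ≤ ω' (p a) a)) := by
    intro p; unfold pb; rw [Finset.mem_filter, hAdef, Finset.mem_filter]; simp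
  -- per-axis thresholds (or emptiness) for the two blocks
  have ax : ∀ (cc : Fin d → Fin (K + 1)) (a : Fin d),
      (∀ c : Fin 3, ¬ cc a ≤ ω' c a) ∨ ∃ t : Fin 3, ∀ c : Fin 3, (cc a ≤ ω' c a ↔ t ≤ c) :=
    fun cc a => threshold_three_le (fun c => ω' c a) (hsort a) (cc a)
  by_cases hE1 : ∃ a ∈ S₁, ∀ c : Fin 3, ¬ c₁ a ≤ ω' c a
  · -- the first orthant pulls back to nothing
    obtain ⟨a₁, ha₁, hno₁⟩ := hE1
    by_cases hE2 : ∃ a ∈ S₂, ∀ c : Fin 3, ¬ c₂ a ≤ ω' c a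
    · obtain ⟨a₂, ha₂, hno₂⟩ := hE2
      have e : pb ω' A = ∅ := by
        ext p; rw [mem_pb]; simp only [Finset.notMem_empty, iff_false, not_or]
        exact ⟨fun h => hno₁ _ (h a₁ ha₁), fun h => hno₂ _ (h a₂ ha₂)⟩
      rw [e, sStarD_empty_left]
    · simp only [not_exists, not_and, not_forall, not_not] at hE2
      have ht : ∀ a, ∃ t : Fin 3, a ∈ S₂ → ∀ c : Fin 3, (c₂ a ≤ ω' c a ↔ t ≤ c) := by
        intro a
        by_cases ha : a ∈ S₂
        · rcases ax c₂ a with h | ⟨t, h⟩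
          · obtain ⟨c, hc⟩ := hE2 a ha; exact absurd hc (h c)
          · exact ⟨t, fun _ => h⟩
        · exact ⟨0, fun h => absurd h ha⟩
      choose t ht using ht
      have e : pb ω' A = univ.filter fun p : Pd d => ∀ a, (if a ∈ S₂ then t a else 0) ≤ p a := by
        ext p; rw [mem_pb, Finset.mem_filter]
        simp only [Finset.mem_univ, true_and]
        constructor
        · rintro (h | h)
          · exact absurd (h a₁ ha₁) (hno₁ _)
          · intro a
            by_cases ha : a ∈ S₂
            · rw [if_pos ha]; exact (ht a ha (p a)).1 (h a ha)
            · rw [if_neg ha]; exact Fin.zero_le _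
        · intro h; refine Or.inr fun a ha => ?_
          have := h a; rw [if_pos ha] at this; exact (ht a ha (p a)).2 this
      rw [e]; exact sStarD_principal_nonneg d _ _ _ hB' hC'
  · simp only [not_exists, not_and, not_forall, not_not] at hE1
    have ht1 : ∀ a, ∃ t : Fin 3, a ∈ S₁ → ∀ c : Fin 3, (c₁ a ≤ ω' c a ↔ t ≤ c) := by
      intro a
      by_cases ha : a ∈ S₁
      · rcases ax c₁ a with h | ⟨t, h⟩
        · obtain ⟨c, hc⟩ := hE1 a ha; exact absurd hc (h c)
        · exact ⟨t, fun _ => h⟩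
      · exact ⟨0, fun h => absurd h ha⟩
    choose t₁ ht₁ using ht1
    by_cases hE2 : ∃ a ∈ S₂, ∀ c : Fin 3, ¬ c₂ a ≤ ω' c a
    · -- only the first orthant survives
      obtain ⟨a₂, ha₂, hno₂⟩ := hE2
      have e : pb ω' A = univ.filter fun p : Pd d => ∀ a, (if a ∈ S₁ then t₁ a else 0) ≤ p a := by
        ext p; rw [mem_pb, Finset.mem_filter]
        simp only [Finset.mem_univ, true_and]
        constructor
        · rintro (h | h)
          · intro a
            by_cases ha : a ∈ S₁
            · rw [if_pos ha]; exact (ht₁ a ha (p a)).1 (h a ha)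
            · rw [if_neg ha]; exact Fin.zero_le _
          · exact absurd (h a₂ ha₂) (hno₂ _)
        · intro h; refine Or.inl fun a ha => ?_
          have := h a; rw [if_pos ha] at this; exact (ht₁ a ha (p a)).2 this
      rw [e]; exact sStarD_principal_nonneg d _ _ _ hB' hC'
    · simp only [not_exists, not_and, not_forall, not_not] at hE2
      have ht2 : ∀ a, ∃ t : Fin 3, a ∈ S₂ → ∀ c : Fin 3, (c₂ a ≤ ω' c a ↔ t ≤ c) := by
        intro a
        by_cases ha : a ∈ S₂
        · rcases ax c₂ a with h | ⟨t, h⟩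
          · obtain ⟨c, hc⟩ := hE2 a ha; exact absurd hc (h c)
          · exact ⟨t, fun _ => h⟩
        · exact ⟨0, fun h => absurd h ha⟩
      choose t₂ ht₂ using ht2
      have e : pb ω' A = univ.filter fun p : Pd d => (∀ a ∈ S₁, t₁ a ≤ p a) ∨ (∀ a ∈ S₂, t₂ a ≤ p a) := by
        ext p; rw [mem_pb, Finset.mem_filter]
        simp only [Finset.mem_univ, true_and]
        exact or_congr (forall₂_congr fun a ha => ht₁ a ha (p a)) (forall₂_congr fun a ha => ht₂ a ha (p a))
      rw [e]; exact sStarD_twoOrthant_union_nonneg S₁ S₂ hdisj t₁ t₂ hB' hC'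

/-- **SAHI'S `C₃` / KAHN'S INEQUALITY WITH AN OR-OF-TWO-ANDS SLOT ON EVERY GRID, homogeneous form** (every `d, K`): for every nonnegative
product weight on `[K+1]^d`, disjoint `S₁, S₂ ⊆ Fin d`, thresholds `c₁, c₂` and all up-sets `B, C`:
`0 ≤ latticeE3 w {x : (∀ a ∈ S₁, c₁ a ≤ x a) ∨ (∀ a ∈ S₂, c₂ a ≤ x a)} B C`. [this work] -/
theorem latticeE3_gridProd_nonneg_orOfAnds (g : Fin d → Fin (K + 1) → ℝ) (hg : ∀ a u, 0 ≤ g a u)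
    (S₁ S₂ : Finset (Fin d)) (hdisj : Disjoint S₁ S₂) (c₁ c₂ : Fin d → Fin (K + 1))
    {B C : Finset (Xd d K)} (hB : IsUpperSet (B : Set (Xd d K))) (hC : IsUpperSet (C : Set (Xd d K))) :
    0 ≤ latticeE3 (fun ω : Xd d K => ∏ a, g a (ω a))
      (univ.filter fun x : Xd d K => (∀ a ∈ S₁, c₁ a ≤ x a) ∨ (∀ a ∈ S₂, c₂ a ≤ x a)) B C := by
  have hcard : (0 : ℝ) < Fintype.card (Fin d → Equiv.Perm (Fin 3)) := by exact_mod_cast Fintype.card_pos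
  have h := latticeE3_symm g (univ.filter fun x : Xd d K => (∀ a ∈ S₁, c₁ a ≤ x a) ∨ (∀ a ∈ S₂, c₂ a ≤ x a)) B C
  have hsum : 0 ≤ ∑ ω : Fin 3 → Xd d K, (∏ c, ∏ a, g a (ω c a)) *
      (Ssym (univ.filter fun x : Xd d K => (∀ a ∈ S₁, c₁ a ≤ x a) ∨ (∀ a ∈ S₂, c₂ a ≤ x a)) B C ω : ℝ) :=
    Finset.sum_nonneg fun ω _ => mul_nonneg (Finset.prod_nonneg fun c _ => Finset.prod_nonneg fun a _ => hg a _)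
      (by exact_mod_cast Ssym_nonneg_orOfAnds S₁ S₂ hdisj c₁ c₂ hB hC ω)
  rw [← h] at hsum
  exact (mul_nonneg_iff_of_pos_left hcard).1 hsum

/-- **KAHN'S `E₃ ≥ 0` FOR AN OR OF TWO ANDS** (probability form, every grid): for every product probability weight `w = ⊗ g_i` on `[K+1]^d`,
disjoint variable sets `S₁, S₂`, thresholds `c₁, c₂`, and all increasing events `B, C`:
`0 ≤ E₃(1_A, 1_B, 1_C)` for `A = {x : (∀ a ∈ S₁, c₁ a ≤ x a) ∨ (∀ a ∈ S₂, c₂ a ≤ x a)}` — Kahn's Conjecture 5 / Sahi's `C₃` when one of the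
three increasing events is a read-once monotone DNF of width two (binary cube: `K = 1`). [this work] -/
theorem sahiE_three_orOfAnds_nonneg (g : Fin d → Fin (K + 1) → ℝ) (hg0 : ∀ i u, 0 ≤ g i u) (hg1 : ∀ i, ∑ u, g i u = 1)
    (S₁ S₂ : Finset (Fin d)) (hdisj : Disjoint S₁ S₂) (c₁ c₂ : Fin d → Fin (K + 1))
    {B C : Finset (Xd d K)} (hB : IsUpperSet (B : Set (Xd d K))) (hC : IsUpperSet (C : Set (Xd d K))) :
    0 ≤ sahiE (fun ω : Xd d K => ∏ i, g i (ω i)) 3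
      ![setInd (univ.filter fun x : Xd d K => (∀ a ∈ S₁, c₁ a ≤ x a) ∨ (∀ a ∈ S₂, c₂ a ≤ x a)), setInd B, setInd C] := by
  classical
  have hsum : ∑ ω : Fin d → Fin (K + 1), ∏ i, g i (ω i) = 1 := by
    rw [← Fintype.prod_sum]; simp [hg1]
  rw [sahiE_three_indicator_eq_latticeE3 hsum]
  exact latticeE3_gridProd_nonneg_orOfAnds g hg0 S₁ S₂ hdisj c₁ c₂ hB hC

end Summit.CriticalPhenomena.PercolationContinuityZ3.Theorems.SahiGridPattern
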